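import Mathlib
import HarnessLib

/-!
# Route BalabanIR — crux 4 `BirGappedPhaseReduction` (item `stmt-HubbardSuperconductivity-2082`):
# `2 × 2`-block bookkeeping: `fromBlocks` of four diagonal matrices

Technical file for the zero-mode temporal coercivity of the BdG reference weight. In the plane-wave
basis the Nambu-doubled BdG matrix of translation-invariant data and the gauge steps are all of the
form

  `Φ(F) := fromBlocks (diagonal F₀₀) (diagonal F₀₁) (diagonal F₁₀) (diagonal F₁₁)`,  `F : m → Matrix (Fin 2) (Fin 2) ℂ`

(one `2 × 2` block per momentum `k : m`). `Φ` is Mathlib's `blockDiagonal F` reindexed along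
`Fin 2 × m ≃ m ⊕ m` (`reindex_blockDiagonal_eq_fromBlocks`), hence a continuous ring homomorphism:
`fromBlocks_diagonal_mul` (`Φ(F)Φ(G) = Φ(FG)`), `fromBlocks_diagonal_one`, `exp_fromBlocks_diagonal`
(`e^{Φ(F)} = Φ(k ↦ e^{F k})`), `det_fromBlocks_diagonal` (`det Φ(F) = ∏_k det F_k`), and the form used
downstream, **`det_one_add_prod_ofFn_fromBlocks_diagonal`**:
`det(1 + ∏_t Φ(F_t)) = ∏_k det(1₂ + ∏_t F_t(k))` — the Trotter determinant of block data factorises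
over the blocks. No definition is introduced (`Φ` is written out). [folklore]
-/

noncomputable section

namespace Summit.HubbardSuperconductivity.HubbardSuperconductivity.Theorems

namespace BirBdG

open Matrix NormedSpace
open scoped Matrix.Norms.Operator

variable {m : Type*} [Fintype m] [DecidableEq m]

omit [Fintype m] in
/-- `blockDiagonal F`, reindexed along `Fin 2 × m ≃ m ⊕ m` (first the block entry, then the block
label), is the `fromBlocks` matrix of the four entry-diagonals. [folklore] -/
theorem reindex_blockDiagonal_eq_fromBlocks (F : m → Matrix (Fin 2) (Fin 2) ℂ) :
    reindex ((finTwoEquiv.prodCongr (Equiv.refl m)).trans (Equiv.boolProdEquivSum m))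
        ((finTwoEquiv.prodCongr (Equiv.refl m)).trans (Equiv.boolProdEquivSum m)) (blockDiagonal F) =
      fromBlocks (diagonal fun k => F k 0 0) (diagonal fun k => F k 0 1)
        (diagonal fun k => F k 1 0) (diagonal fun k => F k 1 1) := by
  ext (i | i) (j | j)
  · show blockDiagonal F (0, i) (0, j) = _
    rw [fromBlocks_apply₁₁, blockDiagonal_apply', diagonal_apply]
  · show blockDiagonal F (0, i) (1, j) = _
    rw [fromBlocks_apply₁₂, blockDiagonal_apply', diagonal_apply]
  · show blockDiagonal F (1, i) (0, j) = _
    rw [fromBlocks_apply₂₁, blockDiagonal_apply', diagonal_apply]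
  · show blockDiagonal F (1, i) (1, j) = _
    rw [fromBlocks_apply₂₂, blockDiagonal_apply', diagonal_apply]

/-- `Φ(F) Φ(G) = Φ(F G)` (blockwise products). [folklore] -/
theorem fromBlocks_diagonal_mul (F G : m → Matrix (Fin 2) (Fin 2) ℂ) :
    fromBlocks (diagonal fun k => F k 0 0) (diagonal fun k => F k 0 1)
        (diagonal fun k => F k 1 0) (diagonal fun k => F k 1 1) *
      fromBlocks (diagonal fun k => G k 0 0) (diagonal fun k => G k 0 1)
        (diagonal fun k => G k 1 0) (diagonal fun k => G k 1 1) =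
      fromBlocks (diagonal fun k => (F k * G k) 0 0) (diagonal fun k => (F k * G k) 0 1)
        (diagonal fun k => (F k * G k) 1 0) (diagonal fun k => (F k * G k) 1 1) := by
  rw [← reindex_blockDiagonal_eq_fromBlocks, ← reindex_blockDiagonal_eq_fromBlocks,
    ← reindex_blockDiagonal_eq_fromBlocks, ← coe_reindexAlgEquiv (R := ℂ) (A := ℂ), ← map_mul,
    ← blockDiagonal_mul]

omit [Fintype m] in
/-- `Φ(1) = 1`. [folklore] -/
theorem fromBlocks_diagonal_one :
    fromBlocks (diagonal fun _ : m => (1 : Matrix (Fin 2) (Fin 2) ℂ) 0 0)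
        (diagonal fun _ : m => (1 : Matrix (Fin 2) (Fin 2) ℂ) 0 1)
        (diagonal fun _ : m => (1 : Matrix (Fin 2) (Fin 2) ℂ) 1 0)
        (diagonal fun _ : m => (1 : Matrix (Fin 2) (Fin 2) ℂ) 1 1) = 1 := by
  have h := reindex_blockDiagonal_eq_fromBlocks (fun _ : m => (1 : Matrix (Fin 2) (Fin 2) ℂ))
  rw [show (fun _ : m => (1 : Matrix (Fin 2) (Fin 2) ℂ)) = 1 from rfl, blockDiagonal_one,
    reindex_apply, submatrix_one_equiv] at h
  exact h.symm

/-- `det Φ(F) = ∏_k det F_k`. [folklore] -/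
theorem det_fromBlocks_diagonal (F : m → Matrix (Fin 2) (Fin 2) ℂ) :
    (fromBlocks (diagonal fun k => F k 0 0) (diagonal fun k => F k 0 1)
        (diagonal fun k => F k 1 0) (diagonal fun k => F k 1 1)).det = ∏ k, (F k).det := by
  rw [← reindex_blockDiagonal_eq_fromBlocks, det_reindex_self, det_blockDiagonal]

/-- `e^{Φ(F)} = Φ(k ↦ e^{F k})`: the exponential of block data is blockwise. [folklore] -/
theorem exp_fromBlocks_diagonal (F : m → Matrix (Fin 2) (Fin 2) ℂ) :
    exp (fromBlocks (diagonal fun k => F k 0 0) (diagonal fun k => F k 0 1)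
        (diagonal fun k => F k 1 0) (diagonal fun k => F k 1 1)) =
      fromBlocks (diagonal fun k => exp (F k) 0 0) (diagonal fun k => exp (F k) 0 1)
        (diagonal fun k => exp (F k) 1 0) (diagonal fun k => exp (F k) 1 1) := by
  rw [← reindex_blockDiagonal_eq_fromBlocks, ← reindex_blockDiagonal_eq_fromBlocks,
    ← coe_reindexAlgEquiv (R := ℂ) (A := ℂ)]
  have h := map_exp (reindexAlgEquiv ℂ ℂ ((finTwoEquiv.prodCongr (Equiv.refl m)).trans
    (Equiv.boolProdEquivSum m))) (continuous_id.matrix_reindex _ _) (blockDiagonal F)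
  have h3 : exp (blockDiagonal F) = blockDiagonal (exp F) := exp_blockDiagonal F
  have h4 : (exp F : m → Matrix (Fin 2) (Fin 2) ℂ) = fun k => exp (F k) := Pi.exp_def F
  have h5 : exp (blockDiagonal F) = blockDiagonal (fun k => exp (F k)) :=
    h3.trans (congrArg blockDiagonal h4)
  refine h.symm.trans ?_
  exact congrArg _ h5

/-- **The Trotter determinant of block data factorises over the blocks**:
`det(1 + ∏_t Φ(F_t)) = ∏_k det(1₂ + ∏_t F_t(k))`. [folklore] -/
theorem det_one_add_prod_ofFn_fromBlocks_diagonal {M : ℕ} (F : Fin M → m → Matrix (Fin 2) (Fin 2) ℂ) :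
    (1 + (List.ofFn fun t => fromBlocks (diagonal fun k => F t k 0 0) (diagonal fun k => F t k 0 1)
        (diagonal fun k => F t k 1 0) (diagonal fun k => F t k 1 1)).prod).det =
      ∏ k, (1 + (List.ofFn fun t => F t k).prod).det := by
  set e : Fin 2 × m ≃ m ⊕ m := (finTwoEquiv.prodCongr (Equiv.refl m)).trans (Equiv.boolProdEquivSum m)
  set Ψ : (m → Matrix (Fin 2) (Fin 2) ℂ) →+* Matrix (m ⊕ m) (m ⊕ m) ℂ :=
    (reindexAlgEquiv ℂ ℂ e).toRingEquiv.toRingHom.comp (blockDiagonalRingHom (Fin 2) m ℂ) with hΨ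
  have hΨF : ∀ G : m → Matrix (Fin 2) (Fin 2) ℂ, Ψ G =
      fromBlocks (diagonal fun k => G k 0 0) (diagonal fun k => G k 0 1)
        (diagonal fun k => G k 1 0) (diagonal fun k => G k 1 1) := fun G => by
    rw [← reindex_blockDiagonal_eq_fromBlocks]
    rfl
  have hlist : (List.ofFn fun t => fromBlocks (diagonal fun k => F t k 0 0) (diagonal fun k => F t k 0 1)
      (diagonal fun k => F t k 1 0) (diagonal fun k => F t k 1 1)) = (List.ofFn F).map Ψ := by
    rw [List.map_ofFn]
    exact congrArg List.ofFn (funext fun t => (hΨF (F t)).symm)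
  rw [hlist, ← map_list_prod, ← map_one Ψ, ← map_add]
  have hdet : ∀ G : m → Matrix (Fin 2) (Fin 2) ℂ, (Ψ G).det = ∏ k, (G k).det := fun G => by
    rw [hΨF, det_fromBlocks_diagonal]
  rw [hdet]
  refine Finset.prod_congr rfl fun k _ => ?_
  rw [Pi.add_apply, Pi.one_apply, ← Pi.evalRingHom_apply (fun _ : m => Matrix (Fin 2) (Fin 2) ℂ) k
    (List.ofFn F).prod, map_list_prod, List.map_ofFn]
  rfl

end BirBdG

end Summit.HubbardSuperconductivity.HubbardSuperconductivity.Theorems
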